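import Mathlib
import Summits.ResolutionOfSingularities.ResolutionOfSingularities.Theses.WeightedInvariant
import Literature.AlgebraicGeometry.Resolution.RegularLocalRingsFlatDescent

/-!
Sketch for crux-ideate stmt-ResolutionOfSingularities-0549 (DescentPerfectToAll), ideator 2, round 1.
First lemmas of the three idea cards; statements only need to ELABORATE (proofs `sorry`).
-/

namespace Summit.ResolutionOfSingularities.ResolutionOfSingularities.Cruxes.DescentPerfectToAll.Sketch

open Polynomial

/-! ## Card 1 — quotient-down-constant-foliation: the Taylor/freeness lemma behind
"smooth rank-one p-closed foliation ⇒ quotient regular" (then flat descent of regularity,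
in tree: `Literature.AlgebraicGeometry.Resolution.IsRegularLocalRing.of_flat_of_isLocalHom`). -/

/-- Char-`p` Taylor lemma (first lemma of card 1): if `δ` is a derivation of a ring `R` of
characteristic `p` with `δ u = 1` and `δ^p = 0`, every element has a unique expansion
`r = ∑_{i<p} cᵢ uⁱ` with `δ cᵢ = 0`; i.e. `R` is free of rank `p` over the ring of constants
`R^δ` with basis `1, u, …, u^{p-1}` (so `R^δ → R` is finite faithfully flat and regularity of
`R` descends to `R^δ`). -/
theorem taylor_expansion_of_derivation (p : ℕ) [Fact p.Prime] (R : Type) [CommRing R]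
    [CharP R p] (δ : Derivation ℤ R R) (u : R) (hu : δ u = 1)
    (hnil : (δ : R →ₗ[ℤ] R) ^ p = 0) (r : R) :
    ∃! c : Fin p → R, (∀ i, δ (c i) = 0) ∧ r = ∑ i : Fin p, c i * u ^ (i : ℕ) := by
  sorry

/-- The one-step descent statement (★★) of card 1 in ring form, as a target shape:
`C ⊆ O` local Noetherian, `O` regular and module-finite FLAT over `C` ⇒ `C` regular
(this is exactly the in-tree Matsumura 23.7(i)). Recorded to show the quotient step closes
over existing declarations. -/
theorem regular_of_finite_flat_cover (C O : Type) [CommRing C] [CommRing O] [Algebra C O]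
    [IsLocalRing C] [IsNoetherianRing C] [IsRegularLocalRing O] [Module.Flat C O]
    [IsLocalHom (algebraMap C O)] : IsRegularLocalRing C :=
  Literature.AlgebraicGeometry.Resolution.IsRegularLocalRing.of_flat_of_isLocalHom C O

/-- Card 1 (cover face), first lemma: regularity of the KUMMER COVER BY A CONSTANT. For a regular
local ring `O` of characteristic `p` and a unit `a` (think: `a ∈ k_j ⊂ O`, a scalar that is not a
`p`-th power in `k_j`), the degree-`p` cover `O[T]/(T^p − a)` (a local ring: `T^p − ā` has one
prime factor over the residue field) is regular iff `a` is not a `p`-th power modulo `𝔪²`, i.e.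
`ν(a) := sup {i : a ∈ O^p + 𝔪^i} ≤ 1`. The one-step crux (★★) asks for a regular model all of
whose local rings satisfy this for the fixed scalar `a` — Giraud's normal-form problem for a
CONSTANT function modulo `p`-th powers. -/
theorem kummer_cover_of_constant_regular_iff (p : ℕ) [Fact p.Prime] (O : Type) [CommRing O]
    [IsRegularLocalRing O] [CharP O p] (a : O) (ha : IsUnit a) :
    IsRegularLocalRing (AdjoinRoot (X ^ p - C a : O[X])) ↔
      ∀ c : O, a - c ^ p ∉ (IsLocalRing.maximalIdeal O) ^ 2 := by
  sorry

/-! ## (dead line, kept for the record) untilt-perturb-descend: the separable untilt exists, but the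
line is dead — `X ⊗_{e_1} K''` need not admit any SMOOTH model (regular non-smooth curves), so the
smooth top model cannot be transferred ϖ-adically; see NOTES.md `## Barrier notes`. -/

/-- The "untilting" polynomial `T^{p^n} − π^M·T − π` is separable (derivative is the unit `−π^M`). -/
theorem separable_untilt (p n M : ℕ) [Fact p.Prime] (K : Type) [Field K] [CharP K p]
    (π : K) (hπ : π ≠ 0) (hn : 0 < n) :
    (X ^ (p ^ n) - C (π ^ M) * X - C π : K[X]).Separable := by
  sorry

/-! ## Card 3 — absolutize-the-datum: the structural fact that makes ground-field-free
differential invariants available on regular F-finite schemes (Kunz 1969 / Tyc 1988 /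
Kimura–Niitsuma: a regular F-finite local ring has a p-basis, so its derivation module is
finite free). -/
theorem derivations_free_of_regular_Ffinite (p : ℕ) [Fact p.Prime] (O : Type) [CommRing O]
    [IsRegularLocalRing O] [CharP O p] (hF : (frobenius O p).Finite) :
    Module.Free O (Derivation ℤ O O) ∧ Module.Finite O (Derivation ℤ O O) := by
  sorry

/-- Card 3, logical shape of the bypass: an all-fields weighted thesis makes the crux a
one-liner (the antecedent is not even used — the refuter's recorded "red flag" is exactly the
point of the bypass). -/
theorem descentPerfectToAll_of_allFields
    (h : ∀ p : ℕ, p.Prime → Literature.AlgebraicGeometry.Resolution.ResolutionInChar.{0} p) :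
    Summit.ResolutionOfSingularities.ResolutionOfSingularities.Theses.WeightedInvariant.DescentPerfectToAll :=
  fun p hp _ => h p hp

end Summit.ResolutionOfSingularities.ResolutionOfSingularities.Cruxes.DescentPerfectToAll.Sketch
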